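import Literature.MathematicalPhysics.QuantumFieldTheory.Balaban1983to89.B12BetaSmooth
import Literature.MathematicalPhysics.QuantumFieldTheory.Balaban1983to89.B12Eq118Analyticity263
import Literature.MathematicalPhysics.QuantumFieldTheory.Balaban1983to89.B12EuclClause263
import Literature.MathematicalPhysics.QuantumFieldTheory.Balaban1983to89.B12GaugeOrbits021
import Literature.MathematicalPhysics.QuantumFieldTheory.Balaban1983to89.B12LargeDomain

/-!
# `Balaban1983to89.B12Carve19Sect1InductiveHyp` — [Balaban1987RG1] Sect. 1 «The Inductive Description of the Effective
# Actions», pp. 260–264 [PDF 12–16], displays (1.1)–(1.22) and Theorem 3: THE HYPOTHESIS-FORM BUNDLE OF CARVING BLOCK 19,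
# with the four printed sentences of the section that the tree carried only as anonymous hypotheses, and the kernel-checked
# passage from the bundle to the consumers' currencies (`Step.SFHyp`, `B12.RunData.IndAss`, `Step.B12Thm3Shape`, (0.25))

statement-level skeleton of published theorems with citation tags; proofs where landed; nothing here is a claim about the Yang–Mills mass gap

SOURCE.  T. Bałaban, *Renormalization group approach to lattice gauge field theories. I. Generation of effective actions in a
small field approximation and a coupling constant renormalization in four dimensions*, Commun. Math. Phys. **109** (1987)
249–301, doi:10.1007/bf01215223 [Balaban1987RG1] (cell paper "B12" = «[I]» of the later papers; held
`paper:balaban1987-cmp109-rg-i-small-field`, journal page = PDF page + 248).  Pages 260–264 were read first-hand for this file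
on the page renders `run/shared/lean/pub/pub-balaban/b2b-balaban-ref1/pages/1987-cmp109-rg-I-small-field/…-p012-x4.png` …
`…-p016-x4.png` (the text layer garbles every display; «p.26N:Lnn» below = line nn of the text-layer file `p00MM.txt`, MM = N − 248 + 12,
of `lit read paper:balaban1987-cmp109-rg-i-small-field --pages 12-16`, running head = L1).  STATUS of the source: published, refereed;
Theorem 3 is proved by the author's account in [I] §§2–5 + [Balaban1988RG2Cluster] p. 22 (the tree's `B12Thm3Assembly`).

WHY THIS FILE (cell `lit-balaban`, P6 CARVING FAN of D-0154 (3b); seat `lit-balaban-carve-19`; block row 19 of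
`run/shared/lean/pub/lit-balaban/carve/BLOCKS-11-20.md`, rules `carve/CARVE-RULES.md`; KEY item `stmt-QuantumFields-20543` (K2⁷
`EndpointGivenBR13SepCoPH`, [B12]∕[B13]), also-feeds `stmt-QuantumFields-20541`, `stmt-QuantumFields-20542`).  The block is
pp. 260–264 = Sect. 1: the background fields (1.1), the space `U_k(ε₀)` (1.2), the form of the action (1.3)∕(1.6) with (1.4)–(1.5), the
localized representation (1.7), the variables `(𝐔, 𝐉)` (1.8)–(1.10), the spaces `U^c_j(X, α₀, α₁, γ₀)` (i)–(iv) (1.11)–(1.16), the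
membership remark (1.17), the bound (1.18), gauge invariance (1.19), the Euclidean clause p. 263, the β-functions (1.20)–(1.22) with the
β-clause of p. 264, and Theorem 3 p. 264.  At statement level this stretch is IN THE TREE (cell SKELETON v3.368: 26 rows, 18 proved,
5 typed-existing, 3 proved-existing; 2168 declarations in 389 files cite a locator in these pages) — so, by the fan's rule «IN TREE =
CITE, NEVER RESTATE», this file (a) RESTATES NOTHING: every printed statement of the block that has a declaration is cited BY NAME
below (table), (b) types the FOUR printed sentences of the block that the tree carries only as ANONYMOUS HYPOTHESES of its theorems
(never as a named statement) — §1: `RegularInDomainPrinted` (p. 260 «For such a configuration there exists … critical orbit», the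
existence half on the data carrier `Setup.Background`), `MinimizersInRegularSpacePrinted` (p. 260 «U_k(V) ∈ U_k(ε₀)»),
`RegularSpaceInSpacesPrinted` (p. 263 «U_k(ε₀), which is contained in all the spaces U^c_j(X, α₀, α₁)»), `LogZGaugeInvariantPrinted`
(p. 263 «an easily verifiable statement for all explicitly defined terms in the action (1.3)») — and (c) conjoins the section's
printed statements, by name, into ONE hypothesis bundle `Hyp` («the inductive assumptions described between (1.1)–(1.22)» AT SCALE
`k`, Theorem 3 p. 264) a node prover can take as `(h : Hyp …)`, with the kernel-checked projections a consumer actually wants: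
`Step.SFHyp` (hence `B12.RunData.IndAss` under `B12StepObligation.RunDict`, and `Step.B12Thm3Shape`), the bound (0.25) at the
backgrounds of the run (`B12LargeDomain`), the gauge and Euclidean invariance of `A_k` (p. 263; `B12GaugeOrbits021`,
`B12EuclClause263`) and the analyticity of the terms AT the backgrounds ((1.9); `B12.Eq118Analyticity263`).

CARRIERS (of record, nothing re-declared).  The cell types Sect. 1 on the small-field TOWER `Step.SFTower P G Φ 𝒢` (module `…Step`,
Part B1: `flow` = (0.18)∕(0.20)∕(1.22), `sys j` = 𝐃_j, `E j X g φ` = 𝐄^{(j)}(X, g_{j−1}, 𝐔, 𝐉) (1.7)–(1.9), `space j X α₀ α₁` =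
U^c_j(X, α₀, α₁) (i)–(iv), `ofBackground` = (1.9) `U ↦ (U, J(U))`, `act` = (1.10), `logZ` = (1.4); `action13`∕`action16`∕`Ek` =
(1.3)∕(1.6)∕(0.23); constants `Step.SFConsts` = Theorem 3's letters), with the background fields (1.1) as the DATA
`Setup.Background P G av` (`dom k`, `U k`, `reg`, `isBackground` — [15] Thm 1 a quoted leaf).  One tower carrier `Φ` for all scales is
the cell's located DIVERGENCE D-f2.1 (`…Step` docstring); the concrete (𝐔, 𝐉)-carriers are `B12RegularSpaces111` ∕ `B12Eq18Current`
∕ `B12Eq115BackgroundPair`; the run-level carrier is `B12.RunData` (`IndAss k`), tied to the tower by `B12StepObligation.RunDict`;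
the printed quantifier shell of Theorem 3 over the constants is `B12.Thm3Printed` (`B12Thm3Assembly.thm3Printed_iff_schedule`).

## The block's SKELETON rows → the in-tree declarations this file CITES (never restates)

| row | print | in tree (module `…Balaban1983to89.<stem>` unless rooted) | used here |
|---|---|---|---|
| B12.Thm3 | Theorem 3 p. 264 | `B12.Thm3Printed` (verbatim, quantifier shell ∃κ₀ ∀κ ∃M(κ) ∀M ∃ε₀ε₁α₀α₁ ∃γ ∀runs); tower shape `Step.B12Thm3Shape`; assembly `B12Thm3Assembly.*`, `B12StepObligation.RunDict`, `B12BetaAsPrinted.Conclusions.c13` | `b12Thm3Shape_of_hyp`, `thm3Clause_of_hyp` |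
| B12.Eq1.1 | (1.1) p. 260 | `IsBackground`, `Background` (module `…Setup`); [15] Thm 1 itself `B11.Thm1Printed`; uniqueness on the data `B12EuclClause263.UniqueModGauge`; orbits `B12GaugeOrbits021.isBackground_gaugeAct` | parameter `bg`; fields `Hyp.regDom`, `Hyp.uniq` |
| B12.Eq1.2, B12.Eq1.2-7, B12.Eq1.2-1.10 | (1.2) p. 260; «regular»; the pair (U, J) | `RegularSpace`, `PlaqSmall`, `FieldPair` (module `…Setup`); p. 260 «By Proposition 2 [12] …» PROVED `B12Prop2Claims260.Claim260Printed_holds`; «implied by the condition on V … Theorem 1 [15]» `B12Eq115BackgroundPair.eq12_of_thm1` ∕ `mem_regularSpace_of_thm1` | parameter `Uk`; fields `Hyp.minInUk`, `Hyp.ukInSpaces` |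
| B12.Eq1.3 | (1.3) p. 260 | `Step.SFTower.action13`; `Step.GeneratedBySmallFieldRT.form13`; `B12.Repr022`; `B12EuclClause263.term13` | conclusions of §3 |
| B12.Eq1.4 | (1.4) p. 260 | `Step.SFTower.logZ` (slot); body `B12Eq15QuadraticForm.Z14`, `NormalizationData.logZ`, `logZ_sub_logZ_one` | `LogZGaugeInvariantPrinted` |
| B12.Eq1.5 | (1.5) p. 261 | `B12Eq15QuadraticForm.Data.eq15`, `eq15_eq_B9_3156`; instance `B12Eq15DictionaryInstance.dataB9` | cited |
| B12.Eq1.6 | (1.6) p. 261 | `Step.SFTower.action16`, `action16_eq`; (1.3) ↔ (1.6) PROVED `B12Eq16From13.action16_absorb`, `exists_form16_of_form13` | `Hyp.gaugeInvariant_action16` |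
| B12.Txt@261 | p. 261 (local dependence, extensions) | `Step.SFHyp.localDep`; `B12.Eq118Analyticity263.SFHypAnalytic` | fields `Hyp.sf`, `Hyp.analytic` |
| B12.Eq1.7 | (1.7) p. 261 | `Step.SFTower.Etot`; `LocExpansion.total` (module `…Setup`); `B16EflSup.FluctuationIntegral.E` | cited |
| B12.Eq1.8 | (1.8) p. 261 | `B12Eq18Current.current`, `imPlaq`; the projection π `B12Eq18Projection.proj`; scale change `B12Eq338CondIV.current_scale` | cited |
| B12.Eq1.9 | (1.9) p. 261 | `Step.SFTower.ofBackground`; concrete `B12Eq18Current.ofBackground`; analyticity word `B12.Eq118Analyticity263.SFHypAnalytic`, `analyticAt_E_ofBackground` | `Hyp.analyticAt_background` |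
| B12.Eq1.10 | (1.10) p. 262 | `B12RegularSpaces111.act` (`gaugeU`, `adJ`, `act_one`, `act_mul`); `Step.SFTower.act`; intertwining with (1.9) `B12GaugeOrbits021.intertwines_of_model`, `B12Eq18Current.ofBackground_gaugeU` | hypothesis `hι` of §3 |
| B12.Eq1.11-1.14, B12.Eq1.11-1.16 | (i)–(iii) (1.11)–(1.14) p. 262 | `B12RegularSpaces111.CondI ∕ CondII ∕ CondIII`, `SatisfiesI_III`; abstract `CplxRegularSpace` (module `…Setup`), `B12RegularSpaces111Mono.cplxRegularSpace` | `T.space` |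
| B12.Eq1.15-1.16, B12.Eq1.15 | (iv) (1.15)–(1.16) p. 262 | `B12RegularSpaces111.CondIV`, `Satisfies`, `space`; the pair (1.15) ASSEMBLED `B12Eq115BackgroundPair.pairOf`, `UHalf.bgOf`; geometry `X̃⁻²` `Node00.Sect2.innerT_subset`, `B13ScaleTransfer.collar` | cited |
| B12.Txt@263 | p. 263 «γ₀ = α₀» | `B12RegularSpaces111.space'` | cited |
| B12.Eq1.17 | (1.17) p. 263 | `B12Eq117Membership.Model.Shape117`, `mem_space_of_shape117` (threshold `2B₃α₀′ ≤ α₀`); on print's instance `B12Eq115BackgroundPair.eq117_of_inputs`, `UHalf.minimal_mem_space'_of_membership`; `B12Eq117Concrete.*` | source of `Hyp.ukInSpaces` in models |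
| B12.Eq1.18 | (1.18) p. 263 | `Step.SFHyp.bound118`; ⇒ (0.25) `B12LargeDomain.bound025_of_bound118`; ⇒ (0.29) on large domains `bound029Large_of_bound118` | `Hyp.bound025` |
| B12.Eq1.19 | (1.19) p. 263 | `Step.SFHyp.gaugeInv119`, `spaceInv`; spaces invariant «by the definition» PROVED `B12RegularSpaces111.act_mem_space_iff`; named shape `B12StepObligation.SpacesGaugeInvariant`; ⇒ `A_k` invariant `B12GaugeOrbits021.gaugeInvariant_action16 ∕ 13` | `Hyp.gaugeInvariant_action13 ∕ 16` |
| B12.Txt@263b | p. 263 Euclidean clause | `B12EuclClause263.EuclClause263`, `action13_nestedInvariant`, `action_comp_background_invariant` | field `Hyp.eucl`; `Hyp.action13_nestedInvariant`, `Hyp.action13_comp_background_invariant` |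
| B12.Eq1.20 | (1.20) p. 264 | `B12PolarizationTensor120.polTensor` (body), `polTensor_global`, `exists_scalar_kernel_polTensor_expChart` (the δ^{ab} reduction), `B12BetaSmooth.PiSmoothSource`, `B12BetaHolo.PiHoloSource` | cited |
| B12.Eq1.21 | (1.21) p. 264 | `B12Beta.Kernel`, `PermCovariant`; `B12PolarizationTensor120.eq121_polTensor`, `polTensor_perm ∕ _refl ∕ _translate`; the limit T^{(j+1)} ↗ ℤ^d `B12Limit51`, `Beta.PolarizationLimit`, `Beta.InfiniteVolume`; `B12BetaAsPrinted.Definitions.d120 ∕ d121` | cited |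
| B12.Eq1.22 | (1.20)–(1.22) + β-clause p. 264 | `B12Beta.secondMoment`; both printed equalities `B12BetaAsPrinted.Definitions.d122` (`BJ86EffectiveAction.fourierT`, `mixedDeriv0`); β-clause `Step.SFHyp.betaSmooth ∕ betaBound`, `B12BetaSmooth.BetaDerivBoundsAt`, `B12CouplingClausesHistory.BetaSmoothInLast264 ∕ BetaDerivsBoundedInLast264 ∕ BetaAnalyticInLast264`, `B12BetaAsPrinted.Conclusions.c264`; source `B12StepObligation.Beta542Source` | fields `Hyp.sf`, `Hyp.betaDerivs` |

## Census of the REMAINING printed sentences of pp. 260–264 (every sentence that asserts something), with disposition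

* p.260:L13–14 «The inductive assumption is based on the results of the previous papers, e.g. see (2.7) [7], (41), (47) [16], and on
  the general remarks in the previous section.» — orientation, no statement (quoted in `…B3` docstring).
* p.260:L15–23 «let us recall the definition of the background field configurations … They are determined by regular gauge field
  configurations V given on the unit lattice T₁^{(k)}. The regularity means that the plaquette variables of V are small, |V(∂p′) − 1| < ε′₀
  for p′ ∈ T₁^{(k)}. For such a configuration there exists exactly one regular, critical orbit of the functional (1.1), and it is a minimal
  orbit (a set of minima). … see Theorem 1 there [15] … We denote by U_k(V), or simply U_k, a configuration in the minimal orbit.» —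
  [15] Thm 1 on [15]'s carriers is `B11.Thm1Printed`; on THIS paper's carrier the tree has the minimiser as DATA (`Setup.Background`:
  `U k V` with `IsBackground` for `V ∈ dom k`, `dom` abstract) and the uniqueness clause as the hypothesis predicate
  `B12EuclClause263.UniqueModGauge`; the EXISTENCE clause «for such a [regular] configuration» — `{V : |V(∂p′) − 1| < ε′₀} ⊆ dom k` — is
  nowhere a named statement on this carrier (the NE-spine node objects `Node00.UkExists ∕ Node00.UniqueUkOrbit` of
  `Node00/BackgroundActionOfRecord` are SU(N)-pinned records, cited only): TYPED
  here, `RegularInDomainPrinted` (§1), bundle fields `regDom` + `uniq`.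
* p.260:L24–26 «The k-th action A_k(V) depends on V through the minimal configuration U_k(V), A_k(V) = A_k(U_k(V)). It is defined on
  configurations belonging to the space U_k(ε₀), i.e., U_k(V) ∈ U_k(ε₀).» — first sentence: `B12.Repr022`,
  `Step.GeneratedBySmallFieldRT.form13`, representative-independence PROVED `B12GaugeOrbits021.action16_eq_of_isBackground_pair`: cited;
  second sentence («U_k(V) ∈ U_k(ε₀)»): PROVED on the concrete carrier from [15] Thm 1's shape (`B12Eq115BackgroundPair.eq12_of_thm1`,
  `mem_regularSpace_of_thm1`) but not a named statement on `Setup.Background`: TYPED here, `MinimizersInRegularSpacePrinted` (§1).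
* p.260:L27–31 (1.2) «with ε₀ sufficiently small» — `Setup.RegularSpace` (the parameter `Uk` below stands for it, see §1): cited.
* p.260:L31–33 «By Proposition 2 [12] this condition implies that |V(∂p′) − 1| < 2ε₀ for p′ ∈ T₁^{(k)}, and is implied by the condition on
  V, with 2ε₀ replaced by B₃⁻¹ε₀, see Theorem 1 [15].» — first half PROVED `B12Prop2Claims260.Claim260Printed_holds` (+ `B12Average012Prop2.claim260_012`),
  second half `B12Eq115BackgroundPair.eq12_of_thm1`: cited (a theorem is not a hypothesis).
* p.260:L36–38 «We have written explicitly terms of the order 0 in the coupling constants. Let us recall that the factor Z^{(j)}(U_k) is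
  given by the Gaussian integral …» (1.4), p.261:L2–5 (1.5) «where the operators H_{1,j}, Δ₁ are defined in Sect. D [13], and C̃^{(2)} … is
  the second order polynomial in the expansion of Q̃(Ū_k^j, B)» — `B12Eq15QuadraticForm.Z14 ∕ Data` (fields `H`, `Δ₁`, `C₂`): cited.
* p.261:L6–10 (1.6) — `Step.SFTower.action16`; PROVED `B12Eq16From13.action16_absorb`: cited.
* p.261:L11–16 «The terms in (1.3) given by explicit formulas, like (1.4), can be easily extended, by the same formulas, to a much wider
  class … G^c-valued configurations satisfying the conditions (3.35)–(3.38) [13], and from results of that paper we conclude that these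
  terms are analytic functions of the configurations. We assume that extensions of this type exist for all terms in the effective
  action (1.3), or (1.6).» — the assumption is `B12.Eq118Analyticity263.SFHypAnalytic` (field `Hyp.analytic`); in the (1.6) reading
  (`B12Eq16From13.absorb`) the explicit terms join the `𝐄`-terms and are covered by it; in the (1.3) reading the tower keeps `log Z^{(j)}`
  REAL and its explicit extension «by the same formulas» is not an object of the tower (`B12.Eq118Analyticity263` HONEST SCOPE (1)) — a
  typing on `T.space` would need the [13] class (3.35)–(3.38) on the abstract `Φ`, which the tower does not carry: ABSORBED by the (1.6)
  reading (said here), not typed separately.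
* p.261:L17–24 (1.7) «the term corresponding to a domain X depends on U_j restricted to X. We can assume that this representation holds
  for the functions E^{(j)} in (1.3) and (1.6), because the expansion of the log Z^{(j−1)}(U_j) constructed in [16], implies, that we can
  represent this term in the form (1.7).» — `Step.SFHyp.localDep`; PROVED at tower level `B12Eq16From13.sfHyp_absorb`,
  `exists_form16_of_form13`: cited.
* p.261:L24–36 «we assume that the terms in (1.7) are determined by functions defined on larger spaces … (3.35)–(3.38) [13], or
  (1.7)–(1.10) [14] … we extend the terms in (1.7) introducing two variables 𝐔, 𝐉» and (1.8) «π denotes the projection … Im U =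
  (1∕2i)(U − U⁻¹)» — `B12Eq18Current.current ∕ imPlaq`, `B12Eq18Projection.proj`, `Setup.FieldPair`: cited; (1.9) `Step.SFTower.ofBackground`.
* p.262:L2–33 (1.10)–(1.16) — `B12RegularSpaces111` (table): cited.  p.262:L18 «with a sufficiently large constant B (it will be
  determined later)» — the letter `Step.SFConsts.Bc` ∕ `B12RegularSpaces111.StepConsts.cB`; no statement.
* p.262:L34–36 «The domain X̃⁻² is obtained from X by taking away two layers of cubes from π_j which are closest to the boundary of X.
  Thus it is a domain X′ such that X̃′² = X.» — geometry is DATA in the (1.16) carrier (`B12RegularSpaces111.Frame.X₂`, DIVERGENCE F5);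
  the operations of record are `B14DomainGeom.innerN` ∕ `Node00.Sect2.innerT` (`innerT_subset`: X̃⁻² ⊂ X) and `enl` ∕ `B13ScaleTransfer.collar`
  (X̃ⁿ, quoting this sentence): cited, not typed (a display of the identity «X̃′² = X» would be this seat's, not the paper's).
* p.262:L36–p.263:L3 «The first three conditions (i)–(iii) … appeared many times in the previous papers … The last condition (iv) is
  connected with the fact that … we have to substitute the functions (1.15) in place of the variables 𝐔, 𝐉.» — commentary, no statement.
* p.263:L3–4 «γ₀ = α₀» — `B12RegularSpaces111.space'`: cited.
* p.263:L6–16 (the membership remark with (1.17)) — `B12Eq117Membership.mem_space_of_shape117`, `B12Eq115BackgroundPair.eq117_of_inputs`,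
  `mem_space_frame_of_inputs`: cited.
* p.263:L16–21 «We specialize this example even more … such that J = D*_𝐔 ξ⁻²π Im ∂𝐔 satisfies the bound |J| < α₀′ … Then the pairs (𝐔, J)
  belong to U^c_j(X, α₀, α₁). In particular the minimal configurations U_j satisfying the bound |∂U_j − 1| < ε₀ξ² with ε₀ sufficiently
  small, satisfy the above conditions.» — PROVED on the concrete carrier at the configuration's OWN scale
  (`B12Eq115BackgroundPair.UHalf.minimal_mem_space'_of_membership`, `B12Eq117Concrete.ofBackground_mem_space'_of_prop9Shape`,
  `B12Lemma4Models.ofBackground_mem_space'_of_prop9Shape_su ∕ _unitary`); at the tower level, where (1.3) reads every `𝐄^{(j)}`, `j ≤ k`, at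
  `U_k` (D-f2.1), the containment is the anonymous hypothesis `hφ` ∕ `hU` ∕ `hmaps` of `B12LargeDomain.bound025_of_bound118`,
  `B12.Eq118Analyticity263.analyticAt_E_ofBackground`, `Node00/Record12ContT`: TYPED here together with p.263:L37–39, `RegularSpaceInSpacesPrinted` (§1).
* p.263:L22–29 (the clause before (1.18) and (1.18)) — `B12.Eq118Analyticity263.SFHypAnalytic` («defined and analytic on the space»),
  `Step.SFHyp.localDep` («depends on … (𝐔, 𝐉)|_X»), `B12BetaSmooth.ESmoothHyp` ∕ `B12CouplingClausesHistory.SmoothInLast263` («C^∞-function of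
  g_{j−1} ∈ [0, γ], (or analytic)»; analytic variant `B12BetaSmooth.EAnalyticAt`, `B12CouplingClausesHistory.AnalyticInLast263`),
  `Step.SFHyp.bound118` ((1.18)); «with some positive, absolute constants α₀, α₁ (i.e., constants independent of X and j)», «a positive,
  absolute γ», «for M ≥ M(κ), γ sufficiently small» = the quantifier placement of `Step.SFConsts` (fixed before `j`, `X`) and of
  `B12.Thm3Printed` ∕ `B12BetaAsPrinted.StandingHypotheses.hM`: cited ∕ ABSORBED by the typing convention.
* p.263:L30–36 (1.19) and «The spaces U^c_j(X, α₀, α₁) are, by the definition, gauge invariant also.» — `Step.SFHyp.gaugeInv119 ∕ spaceInv`;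
  PROVED `B12RegularSpaces111.act_mem_space_iff`: cited.
* p.263:L36–37 «This assumption is an easily verifiable statement for all explicitly defined terms in the action (1.3).» — for the Wilson
  summands PROVED (`B14Eq16FaddeevPopov.wilsonAction4_gaugeAct'`); for the explicit zeroth-order terms `log Z^{(j)}` the tree has ONLY the
  anonymous hypothesis `hZ` of `B12GaugeOrbits021.action13_gaugeAct ∕ gaugeInvariant_action13` and of
  `B12RegularClassInvariance263.action13_comp_background_invariant_blockAvg₂` («`log Z^{(j)}` is an abstract datum of the tower, so its
  invariance is the named hypothesis `hZ`»): TYPED here, `LogZGaugeInvariantPrinted` (§1), same shape (it feeds `hZ`).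
* p.263:L37–39 «These assumptions imply that the action A_k(U) defined on the space U_k(ε₀), which is contained in all the spaces
  U^c_j(X, α₀, α₁), is gauge invariant with respect to all G-valued transformations.» — the implication PROVED
  `B12GaugeOrbits021.gaugeInvariant_action16 ∕ _action13` (re-derived from the bundle: §3); the containment clause: see p.263:L16–21.
* p.263:L40–44 (Euclidean clause) — `B12EuclClause263.EuclClause263` (field `Hyp.eucl`), the implication «clause ⇒ the action (1.3) is
  invariant» PROVED `action13_nestedInvariant`, for `V ↦ A_k(U_k(V))` `action_comp_background_invariant`; explicit terms
  `wilsonAction4_nestedInvariant`; regular classes `B12RegularClassInvariance263.*`: cited (re-derived from the bundle: §3).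
* p.264:L2–4 «the β-functions β_{j+1}(g_j). They are determined by the functions E^{(j+1)}(g_j, U_{j+1}) in (1.6). Let us denote
  E^{(j+1)}(g_j, B) = E^{(j+1)}(g_j, U_{j+1}(exp iB)).» and (1.20) — `B12PolarizationTensor120.expChart ∕ polTensor`, `B12BetaAsPrinted.Definitions.d120`: cited.
* p.264:L6–8 «This is the vacuum polarization tensor … We will analyze this tensor thoroughly in Sect. 5» — no statement.
* p.264:L8–13 «The function E^{(j+1)} is gauge invariant, hence it is invariant with respect to global transformations V → R(v)V, v ∈ G, or
  B → R(v)B. The function (1.20) … values … invariant with respect to the transformations R(v)⊗R(v), v ∈ G. This is possible only if they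
  are proportional to the identity matrix, i.e. to δ^{ab}.» — PROVED `B12PolarizationTensor120.polTensor_global`,
  `exists_scalar_kernel_polTensor_expChart(_killing)` (with `B12Schur433`): cited.
* p.264:L13–19 «By the Euclidean invariance of E^{(j+1)} the function (1.20) is Euclidean covariant. This implies (1.21) where Π_{j+1,μν}(g_j, x)
  is a real valued function, and r is a Euclidean rotation leaving the lattice T^{(j+1)} invariant.» — `B12PolarizationTensor120.eq121_polTensor`,
  `polTensor_perm ∕ _refl ∕ _translate`, `B12Transl58.eq121_finiteVolume`, `B12EuclCov567.*`; real-valuedness = the type `B12Beta.Kernel`;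
  the rotation group as printed in §5 (5.6)–(5.8) `B12BetaAsPrinted.Definitions.d121`: cited.
* p.264:L19–20 «Now we take a limit of these functions as T^{(j+1)} ↗ Z^d. This limit exists by the localized representation (1.7).» —
  `B12Limit51` (subsequential existence + stability of (5.10)), `Beta.PolarizationLimit`, `Beta.InfiniteVolume`, `Beta.EntrywiseVolumeLimit`
  (the located census leaf G-adv2-2 ∕ G-b03g3-1 (e)): cited.
* p.264:L20–24 (1.22) «for μ, ν arbitrary, μ ≠ ν, where f̃(p) denotes the Fourier transform» — `B12Beta.secondMoment`,
  `secondMoment_pair_indep`, `B12BetaAsPrinted.Definitions.d122` (both equalities), `B12Rep537.beta_eq_secondMoment`: cited.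
* p.264:L25–27 «It is a smooth function defined on the interval [0, γ], (or analytic), uniformly bounded on this interval together with all
  derivatives. We will investigate other properties in a separate paper.» — `Step.SFHyp.betaSmooth ∕ betaBound` (order 0),
  `B12BetaSmooth.BetaDerivBoundsAt` («together with all derivatives», field `Hyp.betaDerivs`), `B12StepObligation.BetaSmoothAt`,
  `B12CouplingClausesHistory.Beta*InLast264`, `B12BetaAsPrinted.Conclusions.c264`; the promised paper is recorded as not published
  (`…B12` docstring «Promised continuations»): cited.
* p.264:L28–29 «This completes the description of the inductive assumptions. Now we can formulate a precise version of Theorem 1.» —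
  `B12.thm1_of_thm3_fixedConsts`, `B12Thm3Assembly.thm1Printed_of_thm3Printed`: cited.
* p.264:L30–35 Theorem 3 — `B12.Thm3Printed` (verbatim incl. «The constants ε₀, ε₁, α₀, α₁ depend on M … The constant γ depends on all
  other constants» as quantifier order; `B12Thm3Assembly.thm3Printed_iff_schedule`), `Step.B12Thm3Shape`: cited; §3 links the bundle to both.
* p.264:L36 «In the rest of the paper we will be proving this theorem.» — no statement.

RESULT OF THE CENSUS: four printed sentences of the block without a named declaration on the tree's carriers of Sect. 1 — typed in §1;
everything else is cited.  ROW-CANDIDATES for the [B12] fold owner (r09, vacant; lead books): B12.Txt@260a (p.260:L15–21, existence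
clause on `Setup.Background` → `RegularInDomainPrinted`), B12.Txt@260b (p.260:L24–26 → `MinimizersInRegularSpacePrinted`), B12.Txt@263c
(p.263:L19–21 + L37–39 → `RegularSpaceInSpacesPrinted`), B12.Txt@263d (p.263:L36–37 → `LogZGaugeInvariantPrinted`).

## What is here
* §1 the four residual printed sentences, hypothesis-form (`def …Printed : Prop`), in the frame of the tree's carriers (`Setup.Background`,
  `Setup.PlaqSmall`, `Step.SFTower`, `Step.SFConsts`, `GaugeField.GaugeInvariant`), each exactly the shape of the anonymous hypothesis it
  names where the tree has one.
* §2 `Hyp` — ONE `Prop`-valued structure: «all the inductive assumptions described between (1.1)–(1.22)» AT SCALE `k` for one run's tower,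
  conjoining BY NAME `B12EuclClause263.UniqueModGauge`, `Step.SFHyp`, `B12.Eq118Analyticity263.SFHypAnalytic`, `B12BetaSmooth.ESmoothHyp`,
  `B12EuclClause263.EuclClause263`, `B12BetaSmooth.BetaDerivBoundsAt` and the four §1 statements.
* §3 kernel-checked bookkeeping out of `Hyp` (no new statement asserted): `Hyp.isBackground_of_regular`, `Hyp.eq_gaugeAct_of_isBackground`
  (p. 260, (1.1)); `Hyp.background_mem_space` (p. 263 containment at the run's backgrounds); `Hyp.bound025` ((1.18) ⇒ (0.25) there,
  `B12LargeDomain`); `Hyp.analyticAt_background` ((1.9)); `Hyp.gaugeInvariant_action13 ∕ _action16` (p. 263, `B12GaugeOrbits021`, the `log Z`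
  hypothesis discharged by `Hyp.logZGauge`); `Hyp.action13_nestedInvariant`, `Hyp.action13_comp_background_invariant` (p. 263 Euclidean
  sentences, `B12EuclClause263`, the uniqueness hypothesis discharged by `Hyp.uniq`); `Hyp.betaBound_of_derivs` (order 0 of the β-clause);
  `Hyp.indAss_of_runDict` (`B12.RunData.IndAss k`); and Theorem 3's shape FROM the bundle along a run: `b12Thm3Shape_of_hyp`
  (`Step.B12Thm3Shape`), `thm3Clause_of_hyp` (the innermost clause of `B12.Thm3Printed` for a run datum bound by `RunDict`).

## HONEST SCOPE — what is NOT claimed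
Nothing of [I] is proved here and no `…Printed` statement is asserted: `Hyp` is a HYPOTHESIS bundle and the §1 defs are hypothesis-form
statements; the §3 theorems are bookkeeping between typed shapes.  The definitions (1.20)–(1.22) of Π and β are cited, not bundled (they
are definitions on carriers the abstract tower does not have — `B12PolarizationTensor120`, `B12BetaAsPrinted.Definitions`; the tower sees β
through `flow.β` and its printed clauses); the intertwining of (1.9) with (1.10) («J(U^u) = R(u)J(U)», PROVED for the concrete current,
`B12GaugeOrbits021.intertwines_of_model`) stays the explicit hypothesis `hι` of the two gauge-invariance projections, as in
`B12GaugeOrbits021`; the domain ∕ regular-class invariances of `Hyp.action13_comp_background_invariant` are displayed hypotheses, as in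
`B12EuclClause263.action_comp_background_invariant`.  The parameter `Uk` stands for the printed space `U_k(ε₀)` of (1.2) read on the
`U`-component (`Setup.RegularSpace` is a set of PAIRS (U, J); the tower's `ofBackground` hides `J = J(U)` of (1.8)) — an abstraction of the
same kind as `Step.SFTower.space` for U^c_j.  No summit statement is proved by this file; it moves no node count; nothing continuum ∕ ℝ⁴ ∕
OS ∕ mass-gap ∕ Clay.  No `sorry`, no `instance`, no `notation`, no attribute manipulation; imports five [B12] modules of the tree
(`B12BetaSmooth` → `B12StepObligation` → `B12Sec2to5` → `B12`, `B13`, `Step`, `B12Beta`; `B12Eq118Analyticity263`; `B12EuclClause263`;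
`B12GaugeOrbits021`; `B12LargeDomain`), none of which imports a `Summits` module.
-/

namespace Literature.MathematicalPhysics.QuantumFieldTheory.Balaban1983to89.B12Carve19Sect1InductiveHyp

open Literature.MathematicalPhysics.QuantumFieldTheory.Balaban1983to89
open Literature.MathematicalPhysics.QuantumFieldTheory.Balaban1983to89.Step

variable {P : Params} {G : Type*} [GaugeGroup G] {Φ 𝒢 : Type*} {av : ∀ j, Averaging P j G}

/-! ## §1  The four printed sentences of Sect. 1 the tree carried only as anonymous hypotheses -/

/-- **p. 260 [PDF 12], the background fields — existence clause on the data carrier** (p.260:L15–23, render `…-p012-x4.png`),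
verbatim: *«At first let us recall the definition of the background field configurations on which the k-th action depends. They
are determined by regular gauge field configurations V given on the unit lattice T₁^{(k)}. The regularity means that the plaquette
variables of V are small, |V(∂p′) − 1| < ε′₀ for p′ ∈ T₁^{(k)}. For such a configuration there exists exactly one regular, critical
orbit of the functional  U → A(U),  U : Ū^k = M^k(U) = V on T^{(k)},  (1.1)  and it is a minimal orbit (a set of minima). This
variational problem was investigated in the paper [15], see Theorem 1 there for precise formulations. We denote by U_k(V), or simply
U_k, a configuration in the minimal orbit.»*  The tree carries the minimisers as DATA: `Setup.Background P G av` = a regular class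
`reg`, a domain `dom k` of configurations `V` on `T^{(k)}` and a map `V ↦ U k V` with `IsBackground av reg k V (U k V)` («a minimal
orbit (a set of minima)» on the constraint surface `M^k(U) = V`) for `V ∈ dom k`; the printed EXISTENCE clause — every REGULAR `V`
(«|V(∂p′) − 1| < ε′₀», the tree's `PlaqSmall ε′₀ V`) has its minimiser — is, on this carrier, the inclusion of the regular
configurations in the domain.  THIS def is that inclusion, with print's letter `ε′₀` (p.260:L32–33: one may take `ε′₀ = B₃⁻¹ε₀`,
Theorem 1 [15]); the UNIQUENESS clause («exactly one … orbit») is the tree's `B12EuclClause263.UniqueModGauge av reg k (dom k) (U k)`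
(bundle field `Hyp.uniq`); Theorem 1 [15] itself is `B11.Thm1Printed` on [15]'s carriers (the NE-spine node objects
`Node00.UkExists ∕ Node00.UniqueUkOrbit` of `Node00/BackgroundActionOfRecord` are SU(N)-pinned records, cited only).  Hypothesis-form; nothing is asserted.
[cite: Balaban1987RG1, (1.1) p.260] -/
def RegularInDomainPrinted (bg : Background P G av) (ε'₀ : ℝ) (k : ℕ) : Prop :=
  ∀ V : GaugeField P k G, PlaqSmall ε'₀ V → V ∈ bg.dom k

/-- **p. 260 [PDF 12], «U_k(V) ∈ U_k(ε₀)»** (p.260:L24–26, render `…-p012-x4.png`), verbatim: *«The k-th action A_k(V) depends on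
V through the minimal configuration U_k(V), A_k(V) = A_k(U_k(V)). It is defined on configurations belonging to the space U_k(ε₀),
i.e., U_k(V) ∈ U_k(ε₀). The space was introduced in [14, 15], in a more general context, and here it is defined as the set of all
configurations U satisfying the following regularity properties:  |U(∂p) − 1| = |(∂U)(p) − 1| < ε₀η²,  η = L^{−k},  p ∈ T,  |J| < ε₀
on T,  J = D*_U η^{−2}π Im ∂U,  (1.2)  with ε₀ sufficiently small.»*  The first sentence is the tree's `B12.Repr022` ∕
`Step.GeneratedBySmallFieldRT.form13` (and `B12GaugeOrbits021.action16_eq_of_isBackground_pair`: the value does not depend on the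
representative).  THIS def is the second: every minimiser `U_k(V)`, `V` in the domain of the background data, lies in the space
`U_k(ε₀)` — here the parameter `Uk : Set (GaugeField P 0 G)`, standing for the (1.2) space READ ON THE `U`-COMPONENT (the tree's
`Setup.RegularSpace P k ε₀` is the set of PAIRS `(U, J)`; `J = J(U)` is (1.8), `B12Eq18Current.current`, hidden at the tower level in
`Step.SFTower.ofBackground`).  PROVED on the concrete carrier from Theorem 1 [15]'s shape — p.260:L32–33 *«and is implied by the
condition on V, with 2ε₀ replaced by B₃⁻¹ε₀, see Theorem 1 [15]»* — by `B12Eq115BackgroundPair.eq12_of_thm1` ∕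
`mem_regularSpace_of_thm1`; on `Setup.Background` it is the hypothesis typed here.  Hypothesis-form; nothing is asserted.
[cite: Balaban1987RG1, (1.2) p.260] -/
def MinimizersInRegularSpacePrinted (bg : Background P G av) (Uk : Set (GaugeField P 0 G)) (k : ℕ) : Prop :=
  ∀ V ∈ bg.dom k, bg.U k V ∈ Uk

/-- **p. 263 [PDF 15], «U_k(ε₀), which is contained in all the spaces U^c_j(X, α₀, α₁)»** (p.263:L37–39 with p.263:L16–21, render
`…-p015-x4.png`), verbatim: *«These assumptions imply that the action A_k(U) defined on the space U_k(ε₀), which is contained in all the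
spaces U^c_j(X, α₀, α₁), is gauge invariant with respect to all G-valued transformations.»*, the containment being the content of the
preceding paragraph: *«We specialize this example even more and consider configurations satisfying (i)–(iii) with α′₀, α′₁ as above, and
such that J = D*_𝐔 ξ^{−2}π Im ∂𝐔 satisfies the bound |J| < α′₀, similarly the configuration constructed for U instead of 𝐔. Then the pairs
(𝐔, J) belong to U^c_j(X, α₀, α₁). In particular the minimal configurations U_j satisfying the bound |∂U_j − 1| < ε₀ξ² with ε₀
sufficiently small, satisfy the above conditions.»*  In the frame of the tower (`Step.SFTower`: ONE configuration carrier `Φ` for all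
scales, the located DIVERGENCE D-f2.1; the action (1.3) at scale `k` reads every term `𝐄^{(j)}`, `1 ≤ j ≤ k`, `X ∈ 𝐃_j`, at `U_k`
through the substitution (1.9) `T.ofBackground`): every configuration of `U_k(ε₀)` (the parameter `Uk`, as in
`MinimizersInRegularSpacePrinted`) is carried by `ofBackground` into EVERY space `T.space j X c.α₀ c.α₁`, `1 ≤ j ≤ k`, `X ∈ 𝐃_j` —
with `α₀, α₁` the positive absolute constants of `c : Step.SFConsts` (p.263:L23–24 *«constants independent of X and j»*: fixed before
`j`, `X`).  This is exactly the anonymous hypothesis `hφ` of `B12LargeDomain.bound025_of_bound118`, `hU` of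
`B12.Eq118Analyticity263.SFHypAnalytic.analyticAt_E_ofBackground` and `hmaps` of `Node00/Record12ContT`; PROVED on the concrete carriers at
the configuration's own scale (`B12Eq115BackgroundPair.UHalf.minimal_mem_space'_of_membership`, `B12Eq117Concrete.ofBackground_mem_space'_of_prop9Shape`,
`B12Lemma4Models.ofBackground_mem_space'_of_prop9Shape_su ∕ _unitary`, threshold `2B₃α′₀ ≤ α₀` of `B12Eq117Membership`).  Hypothesis-form;
nothing is asserted. [cite: Balaban1987RG1, §1 p.263 (sentence after (1.19), with the paragraph before (1.18))] -/
def RegularSpaceInSpacesPrinted (Uk : Set (GaugeField P 0 G)) (T : SFTower P G Φ 𝒢) (c : SFConsts) (k : ℕ) : Prop :=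
  ∀ U ∈ Uk, ∀ j, 1 ≤ j → j ≤ k → ∀ X : (T.sys j).Dom, T.ofBackground U ∈ T.space j X c.α₀ c.α₁

/-- **p. 263 [PDF 15], gauge invariance of the explicit terms of (1.3)** (p.263:L36–37, render `…-p015-x4.png`), verbatim (after
(1.19) and the sentence on the spaces): *«This assumption is an easily verifiable statement for all explicitly defined terms in the
action (1.3).»*  The explicitly defined terms of (1.3) are `−(1∕g_k²)A(U_k)`, `−β_{j+1}(g_j)A(U_k)` — gauge invariant as THEOREMS of the
tree (`B14Eq16FaddeevPopov.wilsonAction4_gaugeAct'`, `GaugeGroup.reTr_conj`) — and the zeroth-order terms `log Z^{(j)}(U_k) −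
log Z^{(j)}(1)`, `j = 0, …, k − 1`, of (1.4)–(1.5), which the tower carries as the abstract real slot `Step.SFTower.logZ`; for them the
printed claim is, in the tree, ONLY the anonymous hypothesis `hZ : ∀ j, j < k → ∀ u U, T.logZ j (U^u) = T.logZ j U` of
`B12GaugeOrbits021.action13_gaugeAct ∕ gaugeInvariant_action13` and of `B12RegularClassInvariance263.action13_comp_background_invariant_blockAvg₂`.
THIS def is that statement, with the tree's predicate `GaugeField.GaugeInvariant` (`∀ u U, F (U^u) = F U`, all `G`-valued `u` of `T_η`)
— definitionally the shape of `hZ`.  Hypothesis-form; nothing is asserted (a proof for the Gaussian integral (1.4) would be the gauge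
covariance of `H_{1,j}`, `Δ₁`, `Q̃` of [13] Sect. D, not an object of the tower). [cite: Balaban1987RG1, §1 p.263 (sentence after (1.19)) with (1.3)–(1.4) p.260] -/
def LogZGaugeInvariantPrinted (T : SFTower P G Φ 𝒢) (k : ℕ) : Prop :=
  ∀ j, j < k → GaugeField.GaugeInvariant (T.logZ j)

/-! ## §2  The bundle of block 19: «all the inductive assumptions described between (1.1)–(1.22)» at scale `k`, by name -/

/-- **BLOCK 19 HYPOTHESIS BUNDLE — [B12] Sect. 1 pp. 260–264: the inductive assumptions (1.1)–(1.22) AT SCALE `k`, each the in-tree typed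
statement BY NAME** (Theorem 3 p. 264 [PDF 16]: *«… then the sequence of actions A_k … satisfy all the inductive assumptions described
between (1.1)–(1.22)»*), for the background data `bg : Setup.Background P G av` ((1.1)), the regularity threshold `ε′₀` of `V` (p. 260),
the space `Uk` = `U_k(ε₀)` of (1.2) (read on `U`), the small-field tower `T : Step.SFTower P G Φ 𝒢` ((1.3)–(1.10), the spaces (i)–(iv),
the flow (0.20)∕(1.22)) on a complex normed configuration carrier `Φ` (the word «analytic», `B12.Eq118Analyticity263`), and the constants
`c : Step.SFConsts` (Theorem 3's letters κ, M, γ, ε₀, ε₁, α₀, α₁; E₀ of (1.18); β′; B of (1.12)).  Fields, in print order: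
`regDom` = p. 260 existence clause of (1.1) (`RegularInDomainPrinted`, §1); `uniq` = p. 260 «exactly one … orbit» ([15] Thm 1 on the
data, `B12EuclClause263.UniqueModGauge`); `minInUk` = p. 260 «U_k(V) ∈ U_k(ε₀)» (`MinimizersInRegularSpacePrinted`, §1); `sf` = the cell's
SPINE `Step.SFHyp T c k`: (1.7) local dependence p. 261, (1.18) p. 263, (1.19) with the gauge invariance of the spaces p. 263, the
β-clause of p. 264 at order 0 (smooth; |β_j| ≤ β′ on [0, γ]) and (2.15) = (0.20) for `j < k`; `analytic` = «defined and analytic on the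
space U^c_j(X, α₀, α₁)» p. 263 ∕ (1.9) p. 261 (`B12.Eq118Analyticity263.SFHypAnalytic`); `ukInSpaces` = p. 263 containment
(`RegularSpaceInSpacesPrinted`, §1); `gSmooth` = «a C^∞-function of g_{j−1} ∈ [0, γ]» p. 263 (`B12BetaSmooth.ESmoothHyp`); `logZGauge` =
p. 263 «easily verifiable … for all explicitly defined terms» (`LogZGaugeInvariantPrinted`, §1); `eucl` = the Euclidean clause p. 263
(`B12EuclClause263.EuclClause263`); `betaDerivs` = «uniformly bounded on this interval together with all derivatives» p. 264 for
`β_{j+1}`, `j < k`, in the weakest printed reading — per `j` and per order one bound, no lettered constant (`B12BetaSmooth.BetaDerivBoundsAt`;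
the uniform readings are `B12CouplingClausesHistory.BetaDerivsUniformInLast264`, by name).  The PROVED rows of the block (module docstring
table) are theorems of the tree and therefore not hypotheses; the DEFINITIONS (1.4)–(1.5), (1.8), (1.10)–(1.16), (1.20)–(1.22) are the
cited carriers.  A consumer takes `(h : Hyp …)` and uses §3. [cite: Balaban1987RG1, §1 (1.1)–(1.22) pp.260–264 with Thm 3 p.264] -/
structure Hyp [NormedAddCommGroup Φ] [NormedSpace ℂ Φ] (bg : Background P G av) (ε'₀ : ℝ) (Uk : Set (GaugeField P 0 G))
    (T : SFTower P G Φ 𝒢) (c : SFConsts) (k : ℕ) : Prop where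
  /-- **(1.1), existence** (p. 260 [PDF 12]: «For such a [regular] configuration there exists … critical orbit … minimal») —
  `RegularInDomainPrinted` (§1). [cite: Balaban1987RG1, (1.1) p.260] -/
  regDom : RegularInDomainPrinted bg ε'₀ k
  /-- **(1.1), uniqueness** (p. 260 [PDF 12]: «exactly one regular, critical orbit»; [15] Thm 1) — `B12EuclClause263.UniqueModGauge`.
  [cite: Balaban1987RG1, (1.1) p.260] -/
  uniq : B12EuclClause263.UniqueModGauge av bg.reg k (bg.dom k) (bg.U k)
  /-- **(1.2), «U_k(V) ∈ U_k(ε₀)»** (p. 260 [PDF 12]) — `MinimizersInRegularSpacePrinted` (§1). [cite: Balaban1987RG1, (1.2) p.260] -/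
  minInUk : MinimizersInRegularSpacePrinted bg Uk k
  /-- **(1.7), (1.18), (1.19) + spaces, β-clause (order 0), (2.15)** (pp. 261–264 [PDF 13–16]) — the spine `Step.SFHyp`.
  [cite: Balaban1987RG1, (1.7) p.261, (1.18)–(1.19) p.263, p.264] -/
  sf : SFHyp T c k
  /-- **(1.9) ∕ p. 263 «defined and analytic on the space U^c_j(X, α₀, α₁)»** — `B12.Eq118Analyticity263.SFHypAnalytic`.
  [cite: Balaban1987RG1, (1.9) p.261, (1.18) p.263] -/
  analytic : B12.Eq118Analyticity263.SFHypAnalytic T c k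
  /-- **p. 263 «U_k(ε₀) … contained in all the spaces U^c_j(X, α₀, α₁)»** — `RegularSpaceInSpacesPrinted` (§1).
  [cite: Balaban1987RG1, §1 p.263] -/
  ukInSpaces : RegularSpaceInSpacesPrinted Uk T c k
  /-- **p. 263 «It is a C^∞-function of g_{j−1} ∈ [0, γ]»** — `B12BetaSmooth.ESmoothHyp`. [cite: Balaban1987RG1, p.263 (clause before (1.18))] -/
  gSmooth : B12BetaSmooth.ESmoothHyp T c k
  /-- **p. 263 «an easily verifiable statement for all explicitly defined terms in the action (1.3)»** — `LogZGaugeInvariantPrinted` (§1).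
  [cite: Balaban1987RG1, §1 p.263 (sentence after (1.19))] -/
  logZGauge : LogZGaugeInvariantPrinted T k
  /-- **p. 263 Euclidean clause** («we assume that this is true for all expressions in this term») — `B12EuclClause263.EuclClause263`.
  [cite: Balaban1987RG1, §1 p.263 (last paragraph)] -/
  eucl : B12EuclClause263.EuclClause263 T k
  /-- **p. 264 β-clause, «together with all derivatives»**, for `β_{j+1}`, `j < k`: per `j` one sequence of bounds (weakest printed
  reading) — `B12BetaSmooth.BetaDerivBoundsAt`. [cite: Balaban1987RG1, p.264 (β-clause after (1.22))] -/
  betaDerivs : ∀ j, j < k → ∃ β'n : ℕ → ℝ, B12BetaSmooth.BetaDerivBoundsAt T c j β'n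

/-! ## §3  Kernel-checked bookkeeping out of the bundle (no statement asserted) -/

namespace Hyp

variable [NormedAddCommGroup Φ] [NormedSpace ℂ Φ] {bg : Background P G av} {ε'₀ : ℝ} {Uk : Set (GaugeField P 0 G)}
  {T : SFTower P G Φ 𝒢} {c : SFConsts} {k : ℕ}

/-- **(1.1) for a regular `V`** (p. 260 [PDF 12] «For such a configuration there exists … a minimal orbit»): out of `regDom` and the
background DATA, `U_k(V)` is a constrained minimiser in the tree's sense `Setup.IsBackground` (bookkeeping; [15] Thm 1 is not touched).
[cite: Balaban1987RG1, (1.1) p.260 (bookkeeping)] -/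
theorem isBackground_of_regular (h : Hyp bg ε'₀ Uk T c k) {V : GaugeField P k G} (hV : PlaqSmall ε'₀ V) :
    IsBackground av bg.reg k V (bg.U k V) :=
  bg.isBackground k V (h.regDom V hV)

/-- **(1.1), «exactly one … orbit»** for a regular `V` (p. 260 [PDF 12]): every regular constrained minimiser is a gauge transform of
`U_k(V)` — out of `regDom` and `uniq`. [cite: Balaban1987RG1, (1.1) p.260 (bookkeeping)] -/
theorem eq_gaugeAct_of_isBackground (h : Hyp bg ε'₀ Uk T c k) {V : GaugeField P k G} (hV : PlaqSmall ε'₀ V)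
    {U₁ : GaugeField P 0 G} (hU₁ : IsBackground av bg.reg k V U₁) :
    ∃ u : GaugeTransf P 0 G, U₁ = GaugeField.gaugeAct u (bg.U k V) :=
  h.uniq V (h.regDom V hV) U₁ hU₁

/-- **p. 263 containment AT THE RUN'S BACKGROUNDS**: for `V ∈ dom k`, `(U_k(V), J(U_k(V))) ∈ U^c_j(X, α₀, α₁)` for every `1 ≤ j ≤ k`,
`X ∈ 𝐃_j` — out of `minInUk` (p. 260) and `ukInSpaces` (p. 263); the hypothesis `hφ` ∕ `hU` of `B12LargeDomain` ∕ `B12.Eq118Analyticity263`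
discharged from the bundle. [cite: Balaban1987RG1, §1 p.263 (bookkeeping)] -/
theorem background_mem_space (h : Hyp bg ε'₀ Uk T c k) {V : GaugeField P k G} (hV : V ∈ bg.dom k) {j : ℕ}
    (h1 : 1 ≤ j) (hj : j ≤ k) (X : (T.sys j).Dom) :
    T.ofBackground (bg.U k V) ∈ T.space j X c.α₀ c.α₁ :=
  h.ukInSpaces _ (h.minInUk V hV) j h1 hj X

/-- **(1.18) ⟹ (0.25) at the backgrounds of the run** (p. 263 [PDF 15] with p. 257 [PDF 9]): for `V ∈ dom k`, `1 ≤ j ≤ k`, `g ∈ [0, γ]`,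
the family `X ↦ |𝐄^{(j)}(X, g, U_k(V), J(U_k(V)))|` satisfies `B12.Bound025Printed` with the constants `E₀`, `κ` of (1.18) —
`B12LargeDomain.bound025_of_bound118` with its containment hypothesis fed by `background_mem_space`. [cite: Balaban1987RG1, (1.18) p.263 and (0.25) p.257 (bookkeeping)] -/
theorem bound025 (h : Hyp bg ε'₀ Uk T c k) {V : GaugeField P k G} (hV : V ∈ bg.dom k) {j : ℕ} (h1 : 1 ≤ j)
    (hj : j ≤ k) {g : ℝ} (hg0 : 0 ≤ g) (hgγ : g ≤ c.γ) :
    B12.Bound025Printed (S := T.sys j) (fun X => ‖T.E j X g (T.ofBackground (bg.U k V))‖) c.E₀ c.κ :=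
  B12LargeDomain.bound025_of_bound118 h.sf h1 hj hg0 hgγ fun X => h.background_mem_space hV h1 hj X

/-- **(1.9) at the backgrounds of the run** (p. 261 [PDF 13] with p. 263 [PDF 15]): for `V ∈ dom k` the extension `𝐄^{(j)}(X, g, ·)` is
analytic AT `(U_k(V), J(U_k(V)))` — `B12.Eq118Analyticity263.SFHypAnalytic.analyticAt_E_ofBackground` with its hypothesis `hU` fed by
`background_mem_space`. [cite: Balaban1987RG1, (1.9) p.261 and p.263 (bookkeeping)] -/
theorem analyticAt_background (h : Hyp bg ε'₀ Uk T c k) {V : GaugeField P k G} (hV : V ∈ bg.dom k) {j : ℕ}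
    (h1 : 1 ≤ j) (hj : j ≤ k) (X : (T.sys j).Dom) {g : ℝ} (hg0 : 0 ≤ g) (hgγ : g ≤ c.γ) :
    AnalyticAt ℂ (T.E j X g) (T.ofBackground (bg.U k V)) :=
  h.analytic.analyticAt_E_ofBackground h1 hj X hg0 hgγ (h.background_mem_space hV h1 hj X)

/-- **p. 263 [PDF 15], «the action A_k(U) … is gauge invariant with respect to all G-valued transformations», form (1.3)** — out of
`sf` ((1.19)) and `logZGauge` (the explicit terms), GIVEN the intertwining of the substitution (1.9) with the action (1.10), `hι`
(PROVED for the concrete current by `B12GaugeOrbits021.intertwines_of_model`; a hypothesis for the abstract tower, exactly as in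
`B12GaugeOrbits021.gaugeInvariant_action13`, whose `hZ` is discharged here by the bundle). [cite: Balaban1987RG1, (1.19) p.263 with (1.3) p.260 (bookkeeping)] -/
theorem gaugeInvariant_action13 (h : Hyp bg ε'₀ Uk T c k) (ι : GaugeTransf P 0 G → 𝒢)
    (hι : ∀ u U, T.ofBackground (GaugeField.gaugeAct u U) = T.act (ι u) (T.ofBackground U)) :
    GaugeField.GaugeInvariant (T.action13 k) :=
  B12GaugeOrbits021.gaugeInvariant_action13 T h.sf ι hι fun j hj u U => h.logZGauge j hj u U

/-- **p. 263, the same for the form (1.6)** — `B12GaugeOrbits021.gaugeInvariant_action16` out of `sf`. [cite: Balaban1987RG1, (1.19) p.263 with (1.6) p.261 (bookkeeping)] -/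
theorem gaugeInvariant_action16 (h : Hyp bg ε'₀ Uk T c k) (ι : GaugeTransf P 0 G → 𝒢)
    (hι : ∀ u U, T.ofBackground (GaugeField.gaugeAct u U) = T.act (ι u) (T.ofBackground U)) :
    GaugeField.GaugeInvariant (T.action16 k) :=
  B12GaugeOrbits021.gaugeInvariant_action16 T h.sf ι hι

/-- **p. 263 [PDF 15], «the action (1.3) is invariant with respect to the transformations of the lattice T^{(k)}»** (read on `T_η`:
invariance under the symmetries of `T_η` preserving `T^{(k)}`) — `B12EuclClause263.action13_nestedInvariant` out of `eucl`.
[cite: Balaban1987RG1, §1 p.263 (bookkeeping)] -/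
theorem action13_nestedInvariant (h : Hyp bg ε'₀ Uk T c k) :
    B12EuclClause263.NestedInvariant k (T.action13 k) :=
  B12EuclClause263.action13_nestedInvariant T h.eucl

/-- **p. 263 for `V ↦ A_k(U_k(V))` (p. 260 «A_k(V) = A_k(U_k(V))»)**: at every `V` of the domain, the action (1.3) composed with the
background map is invariant under the translations, centre reflections and coordinate permutations of `T^{(k)}` — out of `uniq`
(the minimal orbit unique modulo gauge), `gaugeInvariant_action13` and `action13_nestedInvariant`, by
`B12EuclClause263.action_comp_background_invariant`, whose displayed hypotheses (domain and regular class stable under the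
transformations, nested-covariant averagings `hav` — e.g. the tree's axial ones, `B12EuclClause263.axial_nestedCovariant'` — and the
intertwining `hι`) stay displayed. [cite: Balaban1987RG1, §1 p.263 with (0.22) p.256 (bookkeeping)] -/
theorem action13_comp_background_invariant (h : Hyp bg ε'₀ Uk T c k)
    (hdomT : ∀ (a : Site P k) (V : GaugeField P k G), V ∈ bg.dom k → V.translate a ∈ bg.dom k)
    (hdomC : ∀ (ρ : Fin P.d) (V : GaugeField P k G), V ∈ bg.dom k → V.creflect ρ ∈ bg.dom k)
    (hdomP : ∀ (π : Equiv.Perm (Fin P.d)) (V : GaugeField P k G), V ∈ bg.dom k → V.permute π ∈ bg.dom k)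
    (hregT : ∀ (a : Site P k) (U : GaugeField P 0 G), U ∈ bg.reg → U.translate (Site.scaleTo k a) ∈ bg.reg)
    (hregC : ∀ (ρ : Fin P.d) (U : GaugeField P 0 G), U ∈ bg.reg → U.creflect ρ ∈ bg.reg)
    (hregP : ∀ (π : Equiv.Perm (Fin P.d)) (U : GaugeField P 0 G), U ∈ bg.reg → U.permute π ∈ bg.reg)
    (hav : B12EuclClause263.AveragingNestedCovariant av)
    (ι : GaugeTransf P 0 G → 𝒢)
    (hι : ∀ u U, T.ofBackground (GaugeField.gaugeAct u U) = T.act (ι u) (T.ofBackground U))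
    {V : GaugeField P k G} (hV : V ∈ bg.dom k) :
    (∀ a : Site P k, T.action13 k (bg.U k (V.translate a)) = T.action13 k (bg.U k V)) ∧
    (∀ ρ : Fin P.d, T.action13 k (bg.U k (V.creflect ρ)) = T.action13 k (bg.U k V)) ∧
    (∀ π : Equiv.Perm (Fin P.d), T.action13 k (bg.U k (V.permute π)) = T.action13 k (bg.U k V)) :=
  B12EuclClause263.action_comp_background_invariant bg k hdomT hdomC hdomP hregT hregC hregP hav h.uniq
    (h.gaugeInvariant_action13 ι hι) h.action13_nestedInvariant hV

/-- **p. 264 β-clause at order 0 out of `betaDerivs`**: `β_{j+1}`, `j < k`, is bounded on `[0, γ]` (the `n = 0` member of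
`B12BetaSmooth.BetaDerivBoundsAt`; the lettered order-0 bound `|β_j| ≤ β′` is `sf.betaBound`). [cite: Balaban1987RG1, p.264 (β-clause; bookkeeping)] -/
theorem betaBound_of_derivs (h : Hyp bg ε'₀ Uk T c k) {j : ℕ} (hj : j < k) :
    ∃ B : ℝ, ∀ x ∈ Set.Icc (0:ℝ) c.γ, |T.flow.β (j+1) x| ≤ B := by
  obtain ⟨β'n, hβ⟩ := h.betaDerivs j hj
  refine ⟨β'n 0, fun x hx => ?_⟩
  have := hβ 0 x hx
  rwa [iteratedDerivWithin_zero] at this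

/-- **The run-level reading** (Theorem 3 p. 264: «A_k … satisfy all the inductive assumptions»): for a run datum `D : B12.RunData` bound to
the tower by `B12StepObligation.RunDict` (`IndAss k ↔ Step.SFHyp T c k`), the bundle at scale `k` gives `D.IndAss k`.
[cite: Balaban1987RG1, Thm 3 p.264 (bookkeeping)] -/
theorem indAss_of_runDict (h : Hyp bg ε'₀ Uk T c k) {D : B12.RunData} (hD : B12StepObligation.RunDict D T c) :
    D.IndAss k :=
  (hD.indAss_iff k).2 h.sf

end Hyp

/-! ### Theorem 3's shape FROM the bundle along a run (the row B12.Thm3's declarations, by name) -/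

section Thm3

variable [NormedAddCommGroup Φ] [NormedSpace ℂ Φ]

/-- **Theorem 3 p. 264 [PDF 16] in the cell's tower SHAPE `Step.B12Thm3Shape`, out of the bundle**: if along the run generated by the
small-field transformations (0.17)–(0.20) with `0 < g_k ≤ γ`, `k ≤ K`, the bundle holds at every scale `k ≤ K` (with the scale-`k` space
`Uk k` = `U_k(ε₀)`), then `Step.B12Thm3Shape av Tk χ GF bg A T c K` — its consequent `Step.SFHyp T c k` is the field `Hyp.sf`.  (The RT
carrier `Setup.RTOp` of that shape is the one flagged in `…Setup` v1.3, DIVERGENCE F17; it is bound here only because the row's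
declaration binds it.) [cite: Balaban1987RG1, Thm 3 p.264 (bookkeeping)] -/
theorem b12Thm3Shape_of_hyp [MeasurableSpace G] [HaarData G] (Tk : ∀ k, RTOp P k G (av k))
    (χ GF : ∀ k, Density P k G) (bg : Background P G av) (A : ∀ k, Density P k G) (ε'₀ : ℝ)
    (Uk : ℕ → Set (GaugeField P 0 G)) (T : SFTower P G Φ 𝒢) (c : SFConsts) (K : ℕ)
    (h : GeneratedBySmallFieldRT av Tk χ GF bg A T K → T.flow.InInterval c.γ K →
      ∀ k, k ≤ K → Hyp bg ε'₀ (Uk k) T c k) :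
    B12Thm3Shape av Tk χ GF bg A T c K :=
  fun hgen hI k hk => (h hgen hI k hk).sf

/-- **The innermost clause of `B12.Thm3Printed` for ONE run, out of the bundle** (p. 264: «if … 0 < g_k ≤ γ for k = 0, 1, …, K, then the
sequence of actions A_k … satisfy all the inductive assumptions described between (1.1)–(1.22)»): for a run datum `D` bound to the tower
by `B12StepObligation.RunDict`, «window ⇒ bundle at every `k ≤ K`» gives «window ⇒ `D.IndAss k` for every `k ≤ K`» — the clause
`B12Thm3Assembly.thm3Clause_*` concludes and `B12Thm3Assembly.thm3Printed_of_*` lifts through the printed quantifier shell.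
[cite: Balaban1987RG1, Thm 3 p.264 (bookkeeping)] -/
theorem thm3Clause_of_hyp (bg : Background P G av) (ε'₀ : ℝ) (Uk : ℕ → Set (GaugeField P 0 G)) {T : SFTower P G Φ 𝒢}
    {c : SFConsts} {K : ℕ} {D : B12.RunData} (hD : B12StepObligation.RunDict D T c)
    (h : T.flow.InInterval c.γ K → ∀ k, k ≤ K → Hyp bg ε'₀ (Uk k) T c k) :
    D.flow.InInterval c.γ K → ∀ k, k ≤ K → D.IndAss k := by
  intro hI k hk
  rw [hD.flow_eq] at hI
  exact (h hI k hk).indAss_of_runDict hD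

end Thm3

end Literature.MathematicalPhysics.QuantumFieldTheory.Balaban1983to89.B12Carve19Sect1InductiveHyp
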